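import Literature.Geometry.Lorentzian.WeightedNorms
import Literature.Geometry.Lorentzian.KerrData
import HarnessLib

/-!
# Characteristic-split weighted distance of initial data sets on a Kerr–Schild slice

Definition request `defn-InitialDataSet.charWeightedEDist` (decomp-fsc lens-2, RESULT-g4.md §3,
2026-08-30; critic riders (i)–(iv): "type the variant D4′ first"), topic
`Literature/Geometry/Lorentzian`, wanted by `stmt-FinalStateConjecture-27603` (gen-5 node
«BasinEntryCells[W]» of `route-FinalStateConjecture-RootDecompKerrBasinLadder`, whose kernel is
checked for an arbitrary window `W`).

**What is defined (variant D4′).** For two initial data sets `D`, `D_ref` on the Kerr–Schild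
slice `Kerr.slice a r₀ ⊆ E3` (global Cartesian chart), put `δh := hFun D − hFun D_ref`,
`δk := kFun D − kFun D_ref` (functions `E3 → (E3 →L E3 →L ℝ)`, `WeightedNorms.lean`) and let
`φ_ij`, `κ_ij` be their Cartesian components. The **characteristic split on Cauchy data** of a
scalar component `φ` with "time derivative" `ϖ` is (with `ρ = ‖y‖`, `∂_ρ` the Euclidean radial
derivative)

  `∂ᵥ^data(ρφ) := ½ ρ (ϖ + ∂_ρ φ + φ/ρ)`,  `∂ᵤ^data(ρφ) := ½ ρ (ϖ − ∂_ρ φ − φ/ρ)`,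

i.e. the values on `{t* = 0}` of `∂ᵥ(ρφ)`, `∂ᵤ(ρφ)` for `∂ᵥ = ½(∂ₜ + ∂_ρ)`, `∂ᵤ = ½(∂ₜ − ∂_ρ)`
(Dafermos–Rodnianski, arXiv:0910.4957, §3: `ψ := rφ`, multiplier `r^p ∂ᵥ`, identity
(p-WE-Mink); p. 4: "a multiplier of the form `r^p(∂ₜ + ∂ᵣ)` for `0 ≤ p ≤ 2`"). For the metric
components the time derivative `ϖ = π[φ_ij]` is READ OFF `k` through the ADM evolution equation
linearised about Kerr in Kerr–Schild form with frozen gauge,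
`∂ₜ δh = −2 N δk + 𝓛_β δh`, `N`, `β` the Kerr–Schild lapse and shift of `g_{M,a} = η + 2H ℓ ⊗ ℓ`
(`Kerr.sliceLapse`, `Kerr.sliceShift`, `InitialDataSet.ksTimeDeriv`). The functional is

  `charWeightedEDist M p s D D_ref := ( Σ_{i,j} Σ_{|w| ≤ s} ∫_U [ ρ^{p−2} |∂ᵥ^data(ρ Γ^w φ_ij ; Γ^w π_ij)|²`
  `      + ρ^{−4} ( |∂ᵤ^data(ρ Γ^w φ_ij ; Γ^w π_ij)|² + |ρ Γ^w φ_ij|² ) ]`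
  `      + Σ_{i,j} Σ_{|w| ≤ s} ∫_U ρ^{p−2} |ρ Γ^w κ_ij|² dy )^{1/2} ∈ [0, ∞]`,

`U = Kerr.slice a r₀`, `dy` Lebesgue measure on `E3`, `Γ^w` a word of length `≤ s` in the
conormal (b-) vector fields tangent to the slice `S = ρ ∂_ρ = y·∇` and `Ω_ij = yᵢ∂ⱼ − yⱼ∂ᵢ`.
In polar form `dy = ρ² dρ dω` the weights read `r^p` on the `∂ᵥ`-terms and `r^{−2}` on
everything else, as requested ("weights `r^p` on `∂ᵥ`-strings (`0 < p < 2`), `r^{−2}` on everything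
else; conormal commutators only").

**Design choices fixed here (requester's informal spec → Lean), all visible in the bodies.**
(Q1) Weights are stated against `dρ dω`, i.e. the Lebesgue integrands carry an extra `ρ^{−2}`.
(Q2) Commutator alphabet on bare Cauchy data = `{S, Ω₀₁, Ω₀₂, Ω₁₂}` (the requested `r∂ᵥ^data` is
not a derivation on data without the field equations; it enters once, as the final split, and
`π[Γ^w φ] := Γ^w π[φ]`). (Q3) Variant D4′ (critic rider): only the METRIC components are split;
all `k`-components are weighted like `∂ᵥ`-terms; `π` uses the Kerr–Schild lapse/shift of
`(M, a)` (so `M` is an explicit argument — the requested signature omitted it). (Q4) `ρ = ‖y‖` is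
the Euclidean radius of the Kerr–Schild Cartesian chart (not the Kerr–Schild `r(a, x)`; they agree
to `O(a²/ρ)`), and `ρ⁻¹`, `ρ^{p−2}`, `ρ^{−4}` take Mathlib's junk value at `ρ = 0` (irrelevant on
`Kerr.slice a r₀` for `r₀ > |a|`, where `ρ > 0`). (Q5) Values in `ℝ≥0∞` via `∫⁻ … ENNReal.ofReal`, no
integrability hypothesis (finiteness is the membership condition), exactly as
`weightedSobolevSeminorm`; only smooth components are intended (`fderiv` is the classical
derivative, junk `0` where not differentiable).

**Status.** This is a DEFINITION serving a route design; it is NOT norm-matched to any printed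
stability basin (the tree's `klainerman_szeftel_kerr_stability_small_a_cauchy[_collar]`,
`hintz_kerr_stability_subextremal_cauchy` are isotropic `H^s_δ` windows, `dataWeightedSobolevEDist`).
No fact is asserted here; the two monotonicity statements of the request (outgoing solutions'
distance `→ 0`; smallness ⟹ small `r^p` flux) are porting-theorem targets of the requester, not
Literature facts (critic NOTE 2026-08-30T04:45:55Z).

## Main definitions (namespace `Literature.Geometry.Lorentzian`)

* `CharSplit.radialDeriv`, `CharSplit.scaling`, `CharSplit.rotation`, `CharSplit.gen`,
  `CharSplit.applyWord` — the scalar b-calculus on `E3 → ℝ`;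
* `CharSplit.dvData`, `CharSplit.duData` — the characteristic split on data;
* `CharSplit.pairEnergy`, `CharSplit.pairEnergyOrder`, `CharSplit.vEnergyOrder` — the weighted
  `ℝ≥0∞`-valued functionals of a scalar pair `(φ, ϖ)` resp. of a `∂ᵥ`-weighted scalar;
* `Kerr.sliceLapse`, `Kerr.sliceShift` — ADM lapse and shift of the Kerr–Schild form on `{t* = 0}`;
* `InitialDataSet.bilinComp`, `InitialDataSet.ksTimeDeriv` — Cartesian components and the
  linearised Kerr–Schild time derivative `π[δh] = −2N δk + 𝓛_β δh`;
* `InitialDataSet.charWeightedEDist M p s D D_ref : ℝ≥0∞` — the distance (D4′).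

API: `applyWord_zero`, `applyWord_neg`, `dvData_zero`, `duData_zero`, `pairEnergy_zero`,
`vEnergyOrder_zero`, `ksTimeDeriv_zero`, `charWeightedEDist_self`.

## References

* M. Dafermos, I. Rodnianski, *A new physical-space approach to decay for the wave equation with
  applications to black hole spacetimes*, XVIth ICMP (2010) 421–432 = arXiv:0910.4957, §3
  (p-WE-Mink), p. 4.
* R. P. Kerr, A. Schild (1965); M. Visser, arXiv:0706.0622, (32)–(35) (Kerr–Schild form).
* R. Bartnik, CPAM 39 (1986), (1.2) (weighted Sobolev seminorms; the isotropic sibling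
  `weightedSobolevSeminorm`).
-/

open Manifold Bundle TopologicalSpace MeasureTheory
open scoped ContDiff Topology ENNReal NNReal

noncomputable section

namespace Literature.Geometry.Lorentzian

/-! ### Scalar b-calculus on `E3 → ℝ` -/

namespace CharSplit

/-- The `i`-th Cartesian unit vector of `E3`. [folklore] -/
def unitVec (i : Fin 3) : E3 := EuclideanSpace.single i (1 : ℝ)

/-- The Euclidean **radial derivative** `∂_ρ φ (y) = Dφ_y (y/‖y‖)` of a scalar function on `E3`
(junk direction `0` at `y = 0`). Dafermos–Rodnianski arXiv:0910.4957, §3 (`∂ᵣ` in `ψ = rφ`,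
`∂ᵥ = ½(∂ₜ + ∂ᵣ)`). [cite: DafermosRodnianski2010ICMP, §3] -/
def radialDeriv (φ : E3 → ℝ) (y : E3) : ℝ := fderiv ℝ φ y (‖y‖⁻¹ • y)

/-- The **scaling (radial b-) derivative** `S φ (y) = ρ ∂_ρ φ (y) = Dφ_y (y)`.
Dafermos–Rodnianski arXiv:0910.4957, p. 4 ("weighted commutation", `r`-weighted vector fields). [cite: DafermosRodnianski2010ICMP, p. 4] -/
def scaling (φ : E3 → ℝ) (y : E3) : ℝ := fderiv ℝ φ y y

/-- The **rotation derivative** `Ω_ij φ (y) = (yᵢ ∂ⱼ − yⱼ ∂ᵢ) φ (y)`. Dafermos–Rodnianski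
arXiv:0910.4957, p. 4 (commutation with angular momentum operators `Ωᵢ`). [cite: DafermosRodnianski2010ICMP, p. 4] -/
def rotation (i j : Fin 3) (φ : E3 → ℝ) (y : E3) : ℝ :=
  fderiv ℝ φ y (y i • unitVec j - y j • unitVec i)

/-- The **commutator alphabet** on Cauchy data: `0 ↦ S = ρ∂_ρ`, `1 ↦ Ω₀₁`, `2 ↦ Ω₀₂`, `3 ↦ Ω₁₂`
(b-vector fields tangent to the slice; design choice (Q2) of the module docstring).
Dafermos–Rodnianski arXiv:0910.4957, p. 4. [cite: DafermosRodnianski2010ICMP, p. 4] -/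
def gen : Fin 4 → (E3 → ℝ) → (E3 → ℝ) :=
  ![scaling, rotation 0 1, rotation 0 2, rotation 1 2]

/-- Apply the **word** `w = (w₀, …, w_{m−1})` of commutators to `φ`:
`Γ^w φ = Γ_{w₀} (Γ_{w₁} ( ⋯ (Γ_{w_{m−1}} φ)))`. Dafermos–Rodnianski arXiv:0910.4957, p. 4
(higher-order weighted energies by commutation). [cite: DafermosRodnianski2010ICMP, p. 4] -/
def applyWord {m : ℕ} (w : Fin m → Fin 4) (φ : E3 → ℝ) : E3 → ℝ :=
  (List.ofFn w).foldr (fun a ψ => gen a ψ) φ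

/-- **`∂ᵥ` on Cauchy data**: `∂ᵥ^data(ρφ)(y) = ½ ρ (ϖ + ∂_ρ φ + φ/ρ)(y)`, the value on the slice
of `∂ᵥ(ρφ)`, `∂ᵥ = ½(∂ₜ + ∂_ρ)`, for a scalar `φ` with time derivative `ϖ`
(`∂ᵥ(ρφ) = ½(ρ ∂ₜφ + ρ ∂_ρφ + φ)`). Dafermos–Rodnianski arXiv:0910.4957, §3 (`ψ := rφ`,
multiplier `r^p ∂ᵥψ`). [cite: DafermosRodnianski2010ICMP, §3 (p-WE-Mink)] -/
def dvData (φ ϖ : E3 → ℝ) (y : E3) : ℝ :=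
  1 / 2 * ‖y‖ * (ϖ y + radialDeriv φ y + φ y / ‖y‖)

/-- **`∂ᵤ` on Cauchy data**: `∂ᵤ^data(ρφ)(y) = ½ ρ (ϖ − ∂_ρ φ − φ/ρ)(y)`, the value on the slice
of `∂ᵤ(ρφ)`, `∂ᵤ = ½(∂ₜ − ∂_ρ)`. Dafermos–Rodnianski arXiv:0910.4957, §3
(`−∂ᵤ∂ᵥψ + Δ̸ψ = 0`). [cite: DafermosRodnianski2010ICMP, §3 (p-WE-Mink)] -/
def duData (φ ϖ : E3 → ℝ) (y : E3) : ℝ :=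
  1 / 2 * ‖y‖ * (ϖ y - radialDeriv φ y - φ y / ‖y‖)

/-- The **characteristic-split weighted energy of a scalar pair** `(φ, ϖ)` over `U ⊆ E3`:
`∫_U [ ρ^{p−2} |∂ᵥ^data(ρφ)|² + ρ^{−4} ( |∂ᵤ^data(ρφ)|² + |ρφ|² ) ] dy ∈ [0, ∞]`, i.e. — in
`dy = ρ² dρ dω` — weight `ρ^p` on the `∂ᵥ`-term and `ρ^{−2}` on everything else (design choice
(Q1)). The `ρ^p |∂ᵥψ|²` density is that of Dafermos–Rodnianski's `r^p`-weighted energy,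
arXiv:0910.4957, §3, (p-WE-Mink), read on the Cauchy slice instead of a null cone. [cite: DafermosRodnianski2010ICMP, §3 (p-WE-Mink)] -/
def pairEnergy (U : Set E3) (p : ℝ) (φ ϖ : E3 → ℝ) : ℝ≥0∞ :=
  ∫⁻ y in U, ENNReal.ofReal
    (‖y‖ ^ (p - 2) * dvData φ ϖ y ^ 2 + ‖y‖ ^ (-4 : ℝ) * (duData φ ϖ y ^ 2 + (‖y‖ * φ y) ^ 2))

/-- The **order-`s` characteristic-split weighted energy** of a scalar pair: the sum of
`pairEnergy U p (Γ^w φ) (Γ^w ϖ)` over all commutator words `w` of length `≤ s` in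
`{S, Ω₀₁, Ω₀₂, Ω₁₂}` (design choice (Q2): `π[Γ^w φ] := Γ^w π[φ]`). Dafermos–Rodnianski
arXiv:0910.4957, p. 4 (higher order weighted energy `E`). [cite: DafermosRodnianski2010ICMP, p. 4] -/
def pairEnergyOrder (U : Set E3) (p : ℝ) (s : ℕ) (φ ϖ : E3 → ℝ) : ℝ≥0∞ :=
  ∑ m ∈ Finset.range (s + 1), ∑ w : Fin m → Fin 4, pairEnergy U p (applyWord w φ) (applyWord w ϖ)

/-- The **order-`s` `∂ᵥ`-weighted energy of a scalar** `κ`: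
`Σ_{|w| ≤ s} ∫_U ρ^{p−2} |ρ Γ^w κ|² dy` (weight `ρ^p` against `dρ dω`) — how variant D4′ weights
every `k`-component (critic rider: "weight all `k`-components like `∂ᵥ`-terms").
Dafermos–Rodnianski arXiv:0910.4957, §3 (the `r^p` weight). [cite: DafermosRodnianski2010ICMP, §3 (p-WE-Mink)] -/
def vEnergyOrder (U : Set E3) (p : ℝ) (s : ℕ) (κ : E3 → ℝ) : ℝ≥0∞ :=
  ∑ m ∈ Finset.range (s + 1), ∑ w : Fin m → Fin 4,
    ∫⁻ y in U, ENNReal.ofReal (‖y‖ ^ (p - 2) * (‖y‖ * applyWord w κ y) ^ 2)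

/-! #### API: the functionals vanish on the zero pair -/

/-- Each commutator kills the zero function (the derivative of a constant vanishes);
Dafermos–Rodnianski arXiv:0910.4957, p. 4 (the commutation vector fields are derivations). [cite: DafermosRodnianski2010ICMP, p. 4] -/
@[simp]
theorem gen_zero (a : Fin 4) : gen a (0 : E3 → ℝ) = 0 := by
  fin_cases a <;> · funext y; simp [gen, scaling, rotation]

/-- Each commutator is odd: `Γ(−φ) = −Γφ` (linearity of the commutation vector fields;
Dafermos–Rodnianski arXiv:0910.4957, p. 4). [cite: DafermosRodnianski2010ICMP, p. 4] -/
theorem gen_neg (a : Fin 4) (φ : E3 → ℝ) : gen a (-φ) = -gen a φ := by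
  fin_cases a <;> · funext y; simp [gen, scaling, rotation, fderiv_neg]

/-- A commutator word kills the zero function (Dafermos–Rodnianski arXiv:0910.4957, p. 4:
linearity of weighted commutation). [cite: DafermosRodnianski2010ICMP, p. 4] -/
@[simp]
theorem applyWord_zero {m : ℕ} (w : Fin m → Fin 4) : applyWord w (0 : E3 → ℝ) = 0 := by
  unfold applyWord
  induction List.ofFn w with
  | nil => rfl
  | cons a l ih => simp only [List.foldr_cons] at ih ⊢; rw [ih, gen_zero]

/-- A commutator word is odd: `Γ^w(−φ) = −Γ^w φ` (Dafermos–Rodnianski arXiv:0910.4957, p. 4: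
linearity of weighted commutation). [cite: DafermosRodnianski2010ICMP, p. 4] -/
theorem applyWord_neg {m : ℕ} (w : Fin m → Fin 4) (φ : E3 → ℝ) :
    applyWord w (-φ) = -applyWord w φ := by
  unfold applyWord
  induction List.ofFn w with
  | nil => rfl
  | cons a l ih => simp only [List.foldr_cons] at ih ⊢; rw [ih, gen_neg]

/-- `∂ᵥ^data` of the zero pair vanishes (linearity of `ψ ↦ ∂ᵥψ`; Dafermos–Rodnianski
arXiv:0910.4957, §3). [cite: DafermosRodnianski2010ICMP, §3 (p-WE-Mink)] -/
@[simp]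
theorem dvData_zero (y : E3) : dvData 0 0 y = 0 := by
  simp [dvData, radialDeriv]

/-- `∂ᵤ^data` of the zero pair vanishes (linearity of `ψ ↦ ∂ᵤψ`; Dafermos–Rodnianski
arXiv:0910.4957, §3). [cite: DafermosRodnianski2010ICMP, §3 (p-WE-Mink)] -/
@[simp]
theorem duData_zero (y : E3) : duData 0 0 y = 0 := by
  simp [duData, radialDeriv]

/-- The pair energy of the zero pair vanishes (the `r^p`-weighted energy is a quadratic form;
Dafermos–Rodnianski arXiv:0910.4957, §3, (p-WE-Mink)). [cite: DafermosRodnianski2010ICMP, §3 (p-WE-Mink)] -/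
@[simp]
theorem pairEnergy_zero (U : Set E3) (p : ℝ) : pairEnergy U p 0 0 = 0 := by
  simp [pairEnergy]

/-- The order-`s` pair energy of the zero pair vanishes (quadratic form; Dafermos–Rodnianski
arXiv:0910.4957, §3, p. 4). [cite: DafermosRodnianski2010ICMP, §3 (p-WE-Mink)] -/
@[simp]
theorem pairEnergyOrder_zero (U : Set E3) (p : ℝ) (s : ℕ) : pairEnergyOrder U p s 0 0 = 0 := by
  simp [pairEnergyOrder]

/-- The order-`s` `∂ᵥ`-weighted energy of the zero function vanishes (quadratic form;
Dafermos–Rodnianski arXiv:0910.4957, §3). [cite: DafermosRodnianski2010ICMP, §3 (p-WE-Mink)] -/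
@[simp]
theorem vEnergyOrder_zero (U : Set E3) (p : ℝ) (s : ℕ) : vEnergyOrder U p s 0 = 0 := by
  simp [vEnergyOrder]

end CharSplit

/-! ### Kerr–Schild lapse and shift on the slice `{t* = 0}` -/

namespace Kerr

/-- The **Kerr–Schild lapse** on the slice: for `g = η + 2H ℓ ⊗ ℓ` with `ℓ₀ = 1` and
`|ℓ⃗|² = 1` (nullity of `ℓ`), the ADM lapse of the foliation `t* = const` is
`N = (1 + 2H)^{−1/2}` (`N⁻² = −g^{00} = 1 + 2H`), evaluated at `x = (0, y)`. Kerr–Schild 1965;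
Visser arXiv:0706.0622, (32)–(35). [cite: KerrSchild1965] -/
def sliceLapse (M a : ℝ) (y : E3) : ℝ :=
  (Real.sqrt (1 + 2 * scalarH M a (E4.ofTimeSpace 0 y)))⁻¹

/-- The **Kerr–Schild shift vector** on the slice: `βᵢ = g_{0i} = 2H ℓᵢ`, raised with the slice
metric `γ_ij = δ_ij + 2H ℓᵢℓⱼ` (using `|ℓ⃗|² = 1`): `βⁱ = 2H ℓᵢ / (1 + 2H)`, at `x = (0, y)`, as
a vector of `E3`. Kerr–Schild 1965; Visser arXiv:0706.0622, (32)–(35). [cite: KerrSchild1965] -/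
def sliceShift (M a : ℝ) (y : E3) : E3 :=
  (2 * scalarH M a (E4.ofTimeSpace 0 y) / (1 + 2 * scalarH M a (E4.ofTimeSpace 0 y))) •
    WithLp.toLp 2 fun i : Fin 3 => nullCovectorFun a (E4.ofTimeSpace 0 y) i.succ

end Kerr

/-! ### The characteristic-split distance of initial data sets (variant D4′) -/

namespace InitialDataSet

/-- Cartesian `(i, j)` component `B(eᵢ, eⱼ)` of a bilinear form on `E3`. [folklore] -/
def bilinComp (B : E3 →L[ℝ] E3 →L[ℝ] ℝ) (i j : Fin 3) : ℝ :=
  B (CharSplit.unitVec i) (CharSplit.unitVec j)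

/-- The **linearised Kerr–Schild time derivative of a metric perturbation**, read off the data:
`π[δh](y) = −2 N(y) δk(y) + (𝓛_β δh)(y)` with
`(𝓛_β δh)(u, v) = (D(δh)_y β(y))(u, v) + δh_y(Dβ_y u, v) + δh_y(u, Dβ_y v)` — the ADM evolution
equation `∂ₜ h = −2N k + 𝓛_β h` linearised about `g_{M,a}` with the gauge (lapse `Kerr.sliceLapse`,
shift `Kerr.sliceShift`) frozen. Design choice (Q3) of the module docstring; ADM equations:
Choquet-Bruhat 2009, Ch. VI, (3.14). [cite: ChoquetBruhat2009, Ch. VI] -/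
def ksTimeDeriv (M a : ℝ) (δh δk : E3 → (E3 →L[ℝ] E3 →L[ℝ] ℝ)) (y : E3) :
    E3 →L[ℝ] E3 →L[ℝ] ℝ :=
  -(2 * Kerr.sliceLapse M a y) • δk y + fderiv ℝ δh y (Kerr.sliceShift M a y) +
    (δh y).bilinearComp (fderiv ℝ (Kerr.sliceShift M a) y) (ContinuousLinearMap.id ℝ E3) +
    (δh y).bilinearComp (ContinuousLinearMap.id ℝ E3) (fderiv ℝ (Kerr.sliceShift M a) y)

/-- `π` of the zero perturbation vanishes (the linearised ADM evolution equation is linear in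
`(δh, δk)`; Choquet-Bruhat 2009, Ch. VI, (3.14)). [cite: ChoquetBruhat2009, Ch. VI] -/
@[simp]
theorem ksTimeDeriv_zero (M a : ℝ) (y : E3) : ksTimeDeriv M a 0 0 y = 0 := by
  have h1 : fderiv ℝ (0 : E3 → (E3 →L[ℝ] E3 →L[ℝ] ℝ)) y = 0 :=
    (hasFDerivAt_const (0 : E3 →L[ℝ] E3 →L[ℝ] ℝ) y).fderiv
  have h2 : (0 : E3 → (E3 →L[ℝ] E3 →L[ℝ] ℝ)) y = 0 := rfl
  have h3 : ∀ f g : E3 →L[ℝ] E3, (0 : E3 →L[ℝ] E3 →L[ℝ] ℝ).bilinearComp f g = 0 := fun f g => by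
    ext u v; simp
  unfold ksTimeDeriv
  rw [h1, h2, h3, h3]
  ext u v
  -- pointwise: `(c • 0 + 0 β + 0 + 0) u v = 0`; the nested `E3 →L E3 →L ℝ` algebra instances
  -- are slow to synthesize under `simp` (cf. the 35 sibling files raising this limit)
  set_option synthInstance.maxHeartbeats 200000 in simp

variable {a r₀ : ℝ}

/-- **Characteristic-split weighted distance of two initial data sets on the Kerr–Schild slice**
(variant D4′ of definition request `defn-InitialDataSet.charWeightedEDist`; see the module
docstring for the informal spec and the design choices (Q1)–(Q5)):
`( Σ_{i,j} pairEnergyOrder U p s (δh_ij) (π[δh]_ij) + Σ_{i,j} vEnergyOrder U p s (δk_ij) )^{1/2}`,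
`U = Kerr.slice a r₀`, `δh = hFun D − hFun D_ref`, `δk = kFun D − kFun D_ref`, `π` the linearised
Kerr–Schild time derivative for parameters `(M, a)`. Weight `ρ^p` (`0 < p < 2` intended) on the
`∂ᵥ`-terms and on all `k`-components, `ρ^{−2}` on everything else, against `dρ dω`; commutators
`{ρ∂_ρ, Ω_ij}` up to order `s`. A route DESIGN (not a printed norm); the `r^p`-weighted density is
Dafermos–Rodnianski's, arXiv:0910.4957, §3 (p-WE-Mink). [cite: DafermosRodnianski2010ICMP, §3 (p-WE-Mink)] -/
def charWeightedEDist (M p : ℝ) (s : ℕ) (D D_ref : InitialDataSet 𝓘(ℝ, E3) (Kerr.slice a r₀)) :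
    ℝ≥0∞ :=
  (∑ i : Fin 3, ∑ j : Fin 3,
      (CharSplit.pairEnergyOrder (Kerr.slice a r₀ : Set E3) p s
          (fun y => bilinComp (D.hFun y - D_ref.hFun y) i j)
          (fun y => bilinComp (ksTimeDeriv M a (D.hFun - D_ref.hFun) (D.kFun - D_ref.kFun) y) i j) +
        CharSplit.vEnergyOrder (Kerr.slice a r₀ : Set E3) p s
          (fun y => bilinComp (D.kFun y - D_ref.kFun y) i j))) ^ (1 / 2 : ℝ)

/-- The characteristic-split distance of a data set to itself is `0` (all integrands are
quadratic in `(δh, δk) = 0`; Dafermos–Rodnianski arXiv:0910.4957, §3, (p-WE-Mink); cf.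
`dataWeightedSobolevEDist_self`). [cite: DafermosRodnianski2010ICMP, §3 (p-WE-Mink)] -/
@[simp]
theorem charWeightedEDist_self (M p : ℝ) (s : ℕ)
    (D : InitialDataSet 𝓘(ℝ, E3) (Kerr.slice a r₀)) : charWeightedEDist M p s D D = 0 := by
  have h₁ : D.hFun - D.hFun = 0 := funext fun y => sub_self (D.hFun y)
  have h₂ : D.kFun - D.kFun = 0 := funext fun y => sub_self (D.kFun y)
  have hπ : ∀ y, ksTimeDeriv M a (D.hFun - D.hFun) (D.kFun - D.kFun) y = 0 := fun y => by
    rw [h₁, h₂, ksTimeDeriv_zero]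
  have e0 : ∀ i j, bilinComp 0 i j = 0 := fun i j => by simp [bilinComp]
  have e1 : ∀ i j, (fun y => bilinComp (D.hFun y - D.hFun y) i j) = 0 := fun i j =>
    funext fun y => by rw [sub_self (D.hFun y), e0]; rfl
  have e2 : ∀ i j,
      (fun y => bilinComp (ksTimeDeriv M a (D.hFun - D.hFun) (D.kFun - D.kFun) y) i j) = 0 :=
    fun i j => funext fun y => by rw [hπ, e0]; rfl
  have e3 : ∀ i j, (fun y => bilinComp (D.kFun y - D.kFun y) i j) = 0 := fun i j =>
    funext fun y => by rw [sub_self (D.kFun y), e0]; rfl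
  unfold charWeightedEDist
  simp only [e1, e2, e3, CharSplit.pairEnergyOrder_zero, CharSplit.vEnergyOrder_zero, add_zero,
    Finset.sum_const_zero]
  exact ENNReal.zero_rpow_of_pos (by norm_num)

end InitialDataSet

end Literature.Geometry.Lorentzian
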